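import Mathlib
import Summits.Ventures.HodgeRepro.Tier4.Common.LocalCoordinates
import Summits.Ventures.HodgeRepro.Tier4.Common.LocalUnitary
import Summits.Ventures.HodgeRepro.Tier4.Common.LocalTorusCompact

/-!
# Tier4/Line4/D3CoeffDecay — C-L4-D3DECAY, part 1: on a row plane at a real CM place, the `4 × 4` real entries of the
`w`-block of `g ∈ U(W)(𝔸)` are bounded by `|α(g)|` (`α = locEntry g 0 0`): `∑ᵢⱼ ‖adToC w (mat g i j)‖ ≤ c · ‖α(g)‖`

Blind re-derivation cell `pub-hodge-repro`, Tier 4 (README §9–§10), seat t4-L1-p5 (prover, gen 4; cut C-L4-D3COEFF,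
the `decay` field of plan-4 g4's (7″) `IsArchCoeffD` — `HasDecay3 W finf := ∃ C, ∀ x, ‖finf x‖ ≤ C · exp(−3 archDist W x)`
with `archSizeAt W w x := ∑ i j, ‖adToC w (GA.mat W x i j)‖` (L1ClassV3, HOME) — the bound below is stated on that explicit
sum, no new definition; S14971).  Target tree path `lean/Summits/Ventures/HodgeRepro/Tier4/Line4/D3CoeffDecay.lean`.
On typer-2's LocalCoordinates p698758 / LocalUnitary p699064 / LocalTorusCompact; Mathlib; no printed input.

WHAT IS PROVED.
* `abs_le_of_form_real` — the positive-definite form at a CM place: `x² + t x y + n y² = N` with `t² < 4n` gives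
  `(4n − t²) y² ≤ 4N`, `(4n − t²) x² ≤ 4n N` (typer-2's `abs_le_of_normOne_real` with `1` replaced by `N`);
* `normSq_blockWeight` — `normSq (blockWeight q w x y) = X² + t_w X Y + n_w Y²` (`X, Y` the real entries at `w`);
  hence `abs_re_adToC_le_norm_blockWeight` / `abs_re_adToC_omega_le_norm_blockWeight`: `|X|, |Y| ≤ c(t, n) · ‖z‖`;
* `norm_adToC_blockOf_le` — every real entry of the block `blockOf t n x y` (`x, y, −n y, x + t y`) is `≤ c′ · ‖z‖`
  with `z = blockWeight q w x y` the complex coordinate of the block;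
* THE `U(1,1)` ENTRY BOUNDS (`normSq_locEntry_zero_one`, `normSq_locEntry_one_zero`, `normSq_locEntry_one_one`):
  under the signature signs `0 < a_w`, `(εb)_w < 0`, `|β|² = (a_w/−(εb)_w)(|α|² − 1)`, `|γ|² = (−(εb)_w/a_w)(|α|² − 1)`,
  `|δ|² = |α|²` — from the row relations `locEntry_unitary` and the inverse relation `locMat_inv_mul_J`;
  `norm_locEntry_le_norm_zero_zero`: every complex entry is `≤ C₁ · ‖α‖`;
* **`sum_norm_adToC_mat_le`** — `∑ i j, ‖adToC w (GA.mat W g i j)‖ ≤ c · ‖locEntry q a b ε w g 0 0‖` with an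
  explicit `c = 16 · c′ · C₁`.

Nothing here says anything about the status of the Hodge conjecture for CM abelian varieties, which is NOT proved
(HC_CM is NOT proved by anyone in this repository).
-/

set_option autoImplicit false

noncomputable section

namespace Summit.Ventures.HodgeRepro.Tier4.Line4

open Summit.Ventures.HodgeRepro.Tier4.Common NumberField Matrix

open scoped ComplexConjugate

section Form

/-- **the positive-definite form at a CM place**: `x² + t x y + n y² = N` with `t² < 4n` bounds `x², y²` by `N`. -/
theorem sq_le_of_form_real {t n x y N : ℝ} (hD : t ^ 2 < 4 * n) (h : x ^ 2 + t * x * y + n * y ^ 2 = N) :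
    (4 * n - t ^ 2) * x ^ 2 ≤ 4 * n * N ∧ (4 * n - t ^ 2) * y ^ 2 ≤ 4 * N := by
  constructor
  · nlinarith [sq_nonneg (2 * n * y + t * x)]
  · nlinarith [sq_nonneg (2 * x + t * y)]

/-- the form is non-negative. -/
theorem form_nonneg {t n x y : ℝ} (hD : t ^ 2 < 4 * n) : 0 ≤ x ^ 2 + t * x * y + n * y ^ 2 := by
  nlinarith [sq_nonneg (2 * x + t * y), sq_nonneg y]

/-- `|x| ≤ √(4n/(4n − t²)) · √N` and `|y| ≤ √(4/(4n − t²)) · √N`. -/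
theorem abs_le_of_form_real {t n x y N : ℝ} (hD : t ^ 2 < 4 * n) (h : x ^ 2 + t * x * y + n * y ^ 2 = N) :
    |x| ≤ Real.sqrt (4 * n / (4 * n - t ^ 2)) * Real.sqrt N ∧
      |y| ≤ Real.sqrt (4 / (4 * n - t ^ 2)) * Real.sqrt N := by
  have hpos : 0 < 4 * n - t ^ 2 := by linarith
  have hN : 0 ≤ N := h ▸ form_nonneg hD
  obtain ⟨hx2, hy2⟩ := sq_le_of_form_real hD h
  constructor
  · rw [← Real.sqrt_mul (div_nonneg (by nlinarith) hpos.le)]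
    apply Real.abs_le_sqrt
    rw [div_mul_eq_mul_div, le_div_iff₀ hpos, mul_comm]
    exact hx2
  · rw [← Real.sqrt_mul (div_nonneg (by norm_num) hpos.le)]
    apply Real.abs_le_sqrt
    rw [div_mul_eq_mul_div, le_div_iff₀ hpos, mul_comm]
    exact hy2

end Form

section Block

variable {k : Type} [Field k] [NumberField k] (q : QuadData k) {w : InfinitePlace k} (hw : w.IsReal)
  (hcm : IsCMAt q w)

include hw in
/-- at a real place `adToC w x` is its real part. -/
theorem adToC_eq_re (x : Ad k) : adToC w x = ((adToC w x).re : ℂ) :=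
  (Complex.ext_iff.2 ⟨by simp, by simp [adToC_im_eq_zero hw x]⟩)

include hw hcm in
/-- **`‖blockWeight q w x y‖² = X² + t_w X Y + n_w Y²`** with `X = (adToC w x).re`, `Y = (adToC w y).re`. -/
theorem normSq_blockWeight (x y : Ad k) :
    Complex.normSq (blockWeight q w x y) =
      (adToC w x).re ^ 2 + (tAt q w).re * (adToC w x).re * (adToC w y).re + (nAt q w).re * (adToC w y).re ^ 2 := by
  have h := blockWeight_mul_conj q w hw hcm x y x y
  have hzero : y * x - x * y = 0 := by ring
  rw [hzero] at h
  have hlhs : blockWeight q w (x * x + algebraMap k (Ad k) q.n * y * y + algebraMap k (Ad k) q.t * x * y) 0 =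
      adToC w x * adToC w x + adToC w (algebraMap k (Ad k) q.n) * adToC w y * adToC w y +
        adToC w (algebraMap k (Ad k) q.t) * adToC w x * adToC w y := by
    simp only [blockWeight, map_add, map_mul, map_zero, zero_mul, add_zero]
  rw [hlhs, Complex.mul_conj] at h
  have hre := congrArg Complex.re h
  rw [adToC_eq_re hw x, adToC_eq_re hw y, adToC_eq_re hw (algebraMap k (Ad k) q.n),
    adToC_eq_re hw (algebraMap k (Ad k) q.t), adToC_t, adToC_n] at hre
  simp only [Complex.ofReal_re, Complex.ofReal_im, Complex.add_re, Complex.mul_re, mul_zero, sub_zero] at hre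
  rw [← hre]
  ring

include hw hcm in
/-- **the real entries of the block are bounded by its complex coordinate**: each of the four entries `x, y, −n y,
x + t y` of `blockOf t n x y` read at `w` has norm `≤ blockBound q w · ‖blockWeight q w x y‖`. -/
theorem norm_adToC_blockOf_le (x y : Ad k) (i j : Fin 2) :
    ‖adToC w (blockOf (algebraMap k (Ad k) q.t) (algebraMap k (Ad k) q.n) x y i j)‖ ≤
      blockBound q w * ‖blockWeight q w x y‖ := by
  set tr := (tAt q w).re with htr
  set nr := (nAt q w).re with hnr
  set X := (adToC w x).re with hX
  set Y := (adToC w y).re with hY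
  set z := blockWeight q w x y with hz
  have hD : tr ^ 2 < 4 * nr := hcm
  have hform : X ^ 2 + tr * X * Y + nr * Y ^ 2 = Complex.normSq z := (normSq_blockWeight q hw hcm x y).symm
  have hsqrt : Real.sqrt (Complex.normSq z) = ‖z‖ := by
    rw [Complex.normSq_eq_norm_sq, Real.sqrt_sq (norm_nonneg _)]
  obtain ⟨hx, hy⟩ := abs_le_of_form_real hD hform
  rw [hsqrt] at hx hy
  set c := Real.sqrt (4 * nr / (4 * nr - tr ^ 2)) + Real.sqrt (4 / (4 * nr - tr ^ 2)) with hc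
  have hz0 : 0 ≤ ‖z‖ := norm_nonneg _
  have hxc : |X| ≤ c * ‖z‖ := hx.trans (by
    rw [hc]; nlinarith [Real.sqrt_nonneg (4 / (4 * nr - tr ^ 2)), hz0])
  have hyc : |Y| ≤ c * ‖z‖ := hy.trans (by
    rw [hc]; nlinarith [Real.sqrt_nonneg (4 * nr / (4 * nr - tr ^ 2)), hz0])
  have hc0 : 0 ≤ c := by
    rw [hc]; positivity
  have hB : blockBound q w = c * (1 + |tr| + |nr|) := rfl
  rw [hB]
  have hnormX : ‖adToC w x‖ = |X| := by
    rw [adToC_eq_re hw x, Complex.norm_real, Real.norm_eq_abs]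
  have hnormY : ‖adToC w y‖ = |Y| := by
    rw [adToC_eq_re hw y, Complex.norm_real, Real.norm_eq_abs]
  have hnormT : ‖adToC w (algebraMap k (Ad k) q.t)‖ = |tr| := by
    rw [adToC_eq_re hw, adToC_t, Complex.norm_real, Real.norm_eq_abs]
  have hnormN : ‖adToC w (algebraMap k (Ad k) q.n)‖ = |nr| := by
    rw [adToC_eq_re hw, adToC_n, Complex.norm_real, Real.norm_eq_abs]
  have hcz : 0 ≤ c * ‖z‖ := mul_nonneg hc0 hz0
  have hcz1 : 0 ≤ c * ‖z‖ * |tr| := mul_nonneg hcz (abs_nonneg tr)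
  have hcz2 : 0 ≤ c * ‖z‖ * |nr| := mul_nonneg hcz (abs_nonneg nr)
  have h1 : c * ‖z‖ ≤ c * (1 + |tr| + |nr|) * ‖z‖ := by nlinarith
  have key : ∀ i j : Fin 2, blockOf (algebraMap k (Ad k) q.t) (algebraMap k (Ad k) q.n) x y i j =
      !![x, -(algebraMap k (Ad k) q.n) * y; y, x + algebraMap k (Ad k) q.t * y] i j := by
    intro i j
    fin_cases i <;> fin_cases j <;> simp [blockOf, omegaMatR] <;> ring
  rw [key]
  fin_cases i <;> fin_cases j
  · simpa [hnormX] using hxc.trans h1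
  · show ‖adToC w (-(algebraMap k (Ad k) q.n) * y)‖ ≤ c * (1 + |tr| + |nr|) * ‖z‖
    rw [map_mul, map_neg, norm_mul, norm_neg, hnormN, hnormY]
    calc |nr| * |Y| ≤ |nr| * (c * ‖z‖) := mul_le_mul_of_nonneg_left hyc (abs_nonneg _)
      _ ≤ c * (1 + |tr| + |nr|) * ‖z‖ := by nlinarith
  · simpa [hnormY] using hyc.trans h1
  · show ‖adToC w (x + algebraMap k (Ad k) q.t * y)‖ ≤ c * (1 + |tr| + |nr|) * ‖z‖
    rw [map_add, map_mul]
    calc ‖adToC w x + adToC w (algebraMap k (Ad k) q.t) * adToC w y‖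
        ≤ ‖adToC w x‖ + ‖adToC w (algebraMap k (Ad k) q.t) * adToC w y‖ := norm_add_le _ _
      _ = |X| + |tr| * |Y| := by rw [norm_mul, hnormX, hnormT, hnormY]
      _ ≤ c * ‖z‖ + |tr| * (c * ‖z‖) := by gcongr
      _ ≤ c * (1 + |tr| + |nr|) * ‖z‖ := by nlinarith

end Block


section Unitary

variable {k : Type} [Field k] [NumberField k] (q : QuadData k) (a b ε : k) (w : InfinitePlace k)
  (hw : w.IsReal) (hcm : IsCMAt q w)

include hw hcm in
/-- row `1` of the unitary relation in real terms: `a_w ‖γ‖² + ε_w b_w ‖δ‖² = ε_w b_w`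
(the `(1,1)` entry of `locEntry_unitary`). -/
theorem normSq_row_one (g : GA (PlaneData.ofLinesRow q a b ε)) :
    (adToC w (algebraMap k (Ad k) a)).re * Complex.normSq (locEntry q a b ε w g 1 0) +
      (adToC w (algebraMap k (Ad k) (ε * b))).re * Complex.normSq (locEntry q a b ε w g 1 1) =
      (adToC w (algebraMap k (Ad k) (ε * b))).re := by
  have h := locEntry_unitary q a b ε w hw hcm (disc_ne_zero_of_isCMAt q w hw hcm) g 1 1
  simp only [if_true, one_ne_zero, if_false, Complex.mul_conj] at h
  rw [adToC_eq_re hw (algebraMap k (Ad k) a), adToC_eq_re hw (algebraMap k (Ad k) (ε * b))] at h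
  have h' := congrArg Complex.re h
  simp only [Complex.add_re, Complex.mul_re, Complex.ofReal_re, Complex.ofReal_im, mul_zero, sub_zero] at h'
  exact h'

include hw hcm in
/-- the `(0,1)` entry of the inverse: `ℓ₀₁(g⁻¹) · (εb)_w = a_w · conj ℓ₁₀(g)` (from `locMat_inv_mul_J`). -/
theorem locEntry_inv_zero_one_mul (g : GA (PlaneData.ofLinesRow q a b ε)) :
    locEntry q a b ε w g⁻¹ 0 1 * adToC w (algebraMap k (Ad k) (ε * b)) =
      adToC w (algebraMap k (Ad k) a) * conj (locEntry q a b ε w g 1 0) := by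
  have h := congrFun (congrFun (locMat_inv_mul_J q a b ε w hw hcm (disc_ne_zero_of_isCMAt q w hw hcm) g) 0) 1
  simp [Jdiag, Matrix.mul_apply, locMat_apply, Matrix.diagonal, Matrix.conjTranspose_apply] at h
  simpa [map_mul] using h

include hw hcm in
/-- **THE `U(1,1)` ENTRY IDENTITIES** under the signature signs `0 < a_w`, `(εb)_w < 0`:
`‖β‖² = (a_w/−(εb)_w)(‖α‖² − 1)`, `‖γ‖² = (−(εb)_w/a_w)(‖α‖² − 1)`, `‖δ‖² = ‖α‖²` (real arithmetic on the row relations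
of `g` and `g⁻¹`, `ℓ₀₀(g⁻¹) = conj ℓ₀₀(g)`, `ℓ₀₁(g⁻¹) (εb)_w = a_w conj ℓ₁₀(g)`). -/
theorem normSq_locEntry_eq (ha : 0 < (adToC w (algebraMap k (Ad k) a)).re)
    (hb : (adToC w (algebraMap k (Ad k) (ε * b))).re < 0) (g : GA (PlaneData.ofLinesRow q a b ε)) :
    Complex.normSq (locEntry q a b ε w g 0 1) =
        (adToC w (algebraMap k (Ad k) a)).re / (-(adToC w (algebraMap k (Ad k) (ε * b))).re) *
          (Complex.normSq (locEntry q a b ε w g 0 0) - 1) ∧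
      Complex.normSq (locEntry q a b ε w g 1 0) =
        (-(adToC w (algebraMap k (Ad k) (ε * b))).re) / (adToC w (algebraMap k (Ad k) a)).re *
          (Complex.normSq (locEntry q a b ε w g 0 0) - 1) ∧
      Complex.normSq (locEntry q a b ε w g 1 1) = Complex.normSq (locEntry q a b ε w g 0 0) := by
  have hq := disc_ne_zero_of_isCMAt q w hw hcm
  set A := (adToC w (algebraMap k (Ad k) a)).re with hA
  set Bv := (adToC w (algebraMap k (Ad k) (ε * b))).re with hBv
  set nA := Complex.normSq (locEntry q a b ε w g 0 0) with hnA
  set nB := Complex.normSq (locEntry q a b ε w g 0 1) with hnB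
  set nG := Complex.normSq (locEntry q a b ε w g 1 0) with hnG
  set nD := Complex.normSq (locEntry q a b ε w g 1 1) with hnD
  set nI := Complex.normSq (locEntry q a b ε w g⁻¹ 0 1) with hnI
  have r0 : A * nA + Bv * nB = A := normSq_entry_sub_normSq q a b ε w hw hcm hq g
  have r1 : A * nG + Bv * nD = Bv := normSq_row_one q a b ε w hw hcm g
  have haC : adToC w (algebraMap k (Ad k) a) ≠ 0 := by
    intro h0
    rw [h0] at hA
    simp at hA
    linarith
  have r0' : A * Complex.normSq (locEntry q a b ε w g⁻¹ 0 0) + Bv * nI = A :=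
    normSq_entry_sub_normSq q a b ε w hw hcm hq g⁻¹
  rw [locEntry_inv_zero_zero q a b ε w hw hcm hq haC g, Complex.normSq_conj] at r0'
  have hinv := congrArg Complex.normSq (locEntry_inv_zero_one_mul q a b ε w hw hcm g)
  rw [Complex.normSq_mul, Complex.normSq_mul, Complex.normSq_conj] at hinv
  have hnsA : Complex.normSq (adToC w (algebraMap k (Ad k) a)) = A ^ 2 := by
    rw [adToC_eq_re hw, Complex.normSq_ofReal]; ring
  have hnsB : Complex.normSq (adToC w (algebraMap k (Ad k) (ε * b))) = Bv ^ 2 := by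
    rw [adToC_eq_re hw, Complex.normSq_ofReal]; ring
  rw [hnsA, hnsB] at hinv
  have hinv' : nI * Bv ^ 2 = A ^ 2 * nG := hinv
  have r0'' : A * nA + Bv * nI = A := r0'
  have hBv0 : Bv ≠ 0 := hb.ne
  have hA0 : A ≠ 0 := ha.ne'
  have hI : nI = nB := by
    have : Bv * nI = Bv * nB := by linarith
    exact mul_left_cancel₀ hBv0 this
  rw [hI] at hinv'
  have hAG : A * (A * nG) = A * (Bv * (1 - nA)) := by linear_combination (-1 : ℝ) * hinv' + Bv * r0
  have hAG' : A * nG = Bv * (1 - nA) := mul_left_cancel₀ hA0 hAG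
  have hG : nG = (-Bv) / A * (nA - 1) := by
    field_simp
    linear_combination hAG'
  refine ⟨?_, hG, ?_⟩
  · field_simp
    linear_combination r0
  · have : Bv * nD = Bv * nA := by linear_combination r1 - hAG'
    exact mul_left_cancel₀ hBv0 this

end Unitary


section SumBound

variable {k : Type} [Field k] [NumberField k] (q : QuadData k) (a b ε : k) (w : InfinitePlace k)
  (hw : w.IsReal) (hcm : IsCMAt q w)

/-- the `ℓ¹` size of the `4 × 4` entries at `w` is the sum of the four blocks' entry sizes (the reindexing
`Fin 2 ⊕ Fin 2 ≃ Fin 4` of `re4R`). -/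
theorem sum_norm_entries_eq_blocks (M : M4 k) :
    ∑ i : Fin 4, ∑ j : Fin 4, ‖adToC w (M i j)‖ =
      ∑ I : Fin 2, ∑ J : Fin 2, ∑ i : Fin 2, ∑ j : Fin 2, ‖adToC w (blocksOf M I J i j)‖ := by
  set N : Matrix (Fin 2 ⊕ Fin 2) (Fin 2 ⊕ Fin 2) (Ad k) :=
    fromBlocks (blocksOf M 0 0) (blocksOf M 0 1) (blocksOf M 1 0) (blocksOf M 1 1) with hN
  have hM : M = re4R N := eq_re4R_fromBlocks M
  have hre : ∀ i j : Fin 4, M i j = N (finSumFinEquiv.symm i) (finSumFinEquiv.symm j) := by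
    intro i j
    conv_lhs => rw [hM]
    simp only [re4R, Matrix.coe_reindexAlgEquiv, Matrix.reindex_apply, Matrix.submatrix_apply]
  simp_rw [hre]
  rw [← Equiv.sum_comp finSumFinEquiv (fun i => ∑ j : Fin 4, ‖adToC w (N (finSumFinEquiv.symm i) (finSumFinEquiv.symm j))‖)]
  simp only [Equiv.symm_apply_apply]
  have hinner : ∀ p : Fin 2 ⊕ Fin 2, (∑ j : Fin 4, ‖adToC w (N p (finSumFinEquiv.symm j))‖) =
      ∑ q : Fin 2 ⊕ Fin 2, ‖adToC w (N p q)‖ := by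
    intro p
    rw [← Equiv.sum_comp finSumFinEquiv (fun j => ‖adToC w (N p (finSumFinEquiv.symm j))‖)]
    simp only [Equiv.symm_apply_apply]
  simp_rw [hinner]
  rw [Fintype.sum_sum_type]
  simp only [Fintype.sum_sum_type, hN, fromBlocks_apply₁₁, fromBlocks_apply₁₂, fromBlocks_apply₂₁,
    fromBlocks_apply₂₂, Fin.sum_univ_two]
  ring


include hw hcm in
/-- **every complex coordinate is bounded by `C₁ · ‖α‖`**, `C₁ := 1 + √(a_w/−(εb)_w) + √(−(εb)_w/a_w)` — from the
`U(1,1)` entry identities and `‖α‖ ≥ 1`. -/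
theorem norm_locEntry_le (ha : 0 < (adToC w (algebraMap k (Ad k) a)).re)
    (hb : (adToC w (algebraMap k (Ad k) (ε * b))).re < 0) (g : GA (PlaneData.ofLinesRow q a b ε)) (I J : Fin 2) :
    ‖locEntry q a b ε w g I J‖ ≤
      (1 + Real.sqrt ((adToC w (algebraMap k (Ad k) a)).re / (-(adToC w (algebraMap k (Ad k) (ε * b))).re)) +
          Real.sqrt ((-(adToC w (algebraMap k (Ad k) (ε * b))).re) / (adToC w (algebraMap k (Ad k) a)).re)) *
        ‖locEntry q a b ε w g 0 0‖ := by
  obtain ⟨hB, hG, hD⟩ := normSq_locEntry_eq q a b ε w hw hcm ha hb g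
  set A := (adToC w (algebraMap k (Ad k) a)).re with hA
  set Bv := (adToC w (algebraMap k (Ad k) (ε * b))).re with hBv
  set α := locEntry q a b ε w g 0 0 with hα
  have hα1 : 1 ≤ ‖α‖ :=
    one_le_norm_locEntry_zero_zero q a b ε w hw hcm (disc_ne_zero_of_isCMAt q w hw hcm) ha hb g
  have hnA : Complex.normSq α = ‖α‖ ^ 2 := Complex.normSq_eq_norm_sq α
  have hnA1 : 1 ≤ Complex.normSq α := by rw [hnA]; nlinarith
  have hr1 : 0 ≤ A / -Bv := div_nonneg ha.le (by linarith)
  have hr2 : 0 ≤ -Bv / A := div_nonneg (by linarith) ha.le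
  set s1 := Real.sqrt (A / -Bv) with hs1def
  set s2 := Real.sqrt (-Bv / A) with hs2def
  have hs1 : 0 ≤ s1 := Real.sqrt_nonneg _
  have hs2 : 0 ≤ s2 := Real.sqrt_nonneg _
  have hα0 : 0 ≤ ‖α‖ := norm_nonneg _
  have key : ∀ (r : ℝ) (z : ℂ), 0 ≤ r → Complex.normSq z ≤ r * Complex.normSq α →
      ‖z‖ ≤ Real.sqrt r * ‖α‖ := by
    intro r z hr hz
    have h1 : ‖z‖ = Real.sqrt (Complex.normSq z) := by
      rw [Complex.normSq_eq_norm_sq, Real.sqrt_sq (norm_nonneg _)]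
    have h2 : ‖α‖ = Real.sqrt (Complex.normSq α) := by
      rw [Complex.normSq_eq_norm_sq, Real.sqrt_sq (norm_nonneg _)]
    rw [h1, h2, ← Real.sqrt_mul hr]
    exact Real.sqrt_le_sqrt hz
  have hs1α : 0 ≤ s1 * ‖α‖ := mul_nonneg hs1 hα0
  have hs2α : 0 ≤ s2 * ‖α‖ := mul_nonneg hs2 hα0
  fin_cases I <;> fin_cases J
  · show ‖α‖ ≤ (1 + s1 + s2) * ‖α‖
    nlinarith
  · have hle : Complex.normSq (locEntry q a b ε w g 0 1) ≤ (A / -Bv) * Complex.normSq α := by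
      rw [hB]; nlinarith
    have h := key _ _ hr1 hle
    show ‖locEntry q a b ε w g 0 1‖ ≤ (1 + s1 + s2) * ‖α‖
    nlinarith
  · have hle : Complex.normSq (locEntry q a b ε w g 1 0) ≤ (-Bv / A) * Complex.normSq α := by
      rw [hG]; nlinarith
    have h := key _ _ hr2 hle
    show ‖locEntry q a b ε w g 1 0‖ ≤ (1 + s1 + s2) * ‖α‖
    nlinarith
  · have hle : Complex.normSq (locEntry q a b ε w g 1 1) ≤ (1 : ℝ) * Complex.normSq α := by
      rw [hD]; linarith
    have h := key _ _ zero_le_one hle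
    rw [Real.sqrt_one, one_mul] at h
    show ‖locEntry q a b ε w g 1 1‖ ≤ (1 + s1 + s2) * ‖α‖
    nlinarith

include hw hcm in
/-- **THE ENTRY BOUND ON THE ROW PLANE**: `∑ᵢⱼ ‖adToC w (mat g i j)‖ ≤ 16 · blockBound q w · C₁ · ‖α(g)‖` —
the `ℓ¹` size of the `w`-block of `g` (plan-4's `archSizeAt`, written out) is bounded by the coefficient's `|α|`. -/
theorem sum_norm_adToC_mat_le (ha : 0 < (adToC w (algebraMap k (Ad k) a)).re)
    (hb : (adToC w (algebraMap k (Ad k) (ε * b))).re < 0) (g : GA (PlaneData.ofLinesRow q a b ε)) :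
    ∑ i : Fin 4, ∑ j : Fin 4, ‖adToC w (GA.mat (PlaneData.ofLinesRow q a b ε) g i j)‖ ≤
      16 * blockBound q w *
        (1 + Real.sqrt ((adToC w (algebraMap k (Ad k) a)).re / (-(adToC w (algebraMap k (Ad k) (ε * b))).re)) +
          Real.sqrt ((-(adToC w (algebraMap k (Ad k) (ε * b))).re) / (adToC w (algebraMap k (Ad k) a)).re)) *
        ‖locEntry q a b ε w g 0 0‖ := by
  set C₁ := 1 + Real.sqrt ((adToC w (algebraMap k (Ad k) a)).re / (-(adToC w (algebraMap k (Ad k) (ε * b))).re)) +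
    Real.sqrt ((-(adToC w (algebraMap k (Ad k) (ε * b))).re) / (adToC w (algebraMap k (Ad k) a)).re) with hC₁
  set α := locEntry q a b ε w g 0 0 with hα
  set M := GA.mat (PlaneData.ofLinesRow q a b ε) g with hM
  rw [sum_norm_entries_eq_blocks]
  have hblock : ∀ I J : Fin 2, ∑ i : Fin 2, ∑ j : Fin 2, ‖adToC w (blocksOf M I J i j)‖ ≤
      4 * (blockBound q w * (C₁ * ‖α‖)) := by
    intro I J
    have hentry : ∀ i j : Fin 2, ‖adToC w (blocksOf M I J i j)‖ ≤ blockBound q w * (C₁ * ‖α‖) := by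
      intro i j
      have hloc : locEntry q a b ε w g I J =
          blockWeight q w (M (lineBase I) (lineBase J)) (M (lineOmega I) (lineBase J)) := by
        rw [locEntry_eq_blockWeight, blocks_eq_blockOf, blockOf_apply_zero_zero, blockOf_apply_one_zero]
      calc ‖adToC w (blocksOf M I J i j)‖
          ≤ blockBound q w * ‖blockWeight q w (M (lineBase I) (lineBase J)) (M (lineOmega I) (lineBase J))‖ := by
            rw [hM, blocks_eq_blockOf]
            exact norm_adToC_blockOf_le q hw hcm _ _ i j
        _ = blockBound q w * ‖locEntry q a b ε w g I J‖ := by rw [hloc]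
        _ ≤ blockBound q w * (C₁ * ‖α‖) :=
            mul_le_mul_of_nonneg_left (norm_locEntry_le q a b ε w hw hcm ha hb g I J) (blockBound_nonneg q w)
    calc ∑ i : Fin 2, ∑ j : Fin 2, ‖adToC w (blocksOf M I J i j)‖
        ≤ ∑ i : Fin 2, ∑ j : Fin 2, blockBound q w * (C₁ * ‖α‖) :=
          Finset.sum_le_sum fun i _ => Finset.sum_le_sum fun j _ => hentry i j
      _ = 4 * (blockBound q w * (C₁ * ‖α‖)) := by simp; ring
  calc ∑ I : Fin 2, ∑ J : Fin 2, ∑ i : Fin 2, ∑ j : Fin 2, ‖adToC w (blocksOf M I J i j)‖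
      ≤ ∑ I : Fin 2, ∑ J : Fin 2, 4 * (blockBound q w * (C₁ * ‖α‖)) :=
        Finset.sum_le_sum fun I _ => Finset.sum_le_sum fun J _ => hblock I J
    _ = 16 * blockBound q w * C₁ * ‖α‖ := by simp; ring

end SumBound

end Summit.Ventures.HodgeRepro.Tier4.Line4

end
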